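import Mathlib.Data.List.Chain
import Mathlib.Data.List.Infix
import Mathlib.Data.List.Nodup
import Mathlib.Data.List.Range
import HarnessLib

/-!
# Lists assembled from consecutive blocks
(route CardyQContinuation, serves stmt-CriticalPhenomena-5560: helper for the registered stub
`stub_design_meshQuad` of the n = 0 bridge of the crux `IsingJetsConformal`; generic list
bookkeeping, Mathlib-only)

The boundary polygon of a Chelkak–Smirnov polygonal domain is written as the concatenation, over
the positions of the boundary cycle, of short blocks of vertices (the contribution of the arrows
walked from a dart, of a white dart, of a junction). This file provides the bookkeeping for such
lists `flatMapRange blk lo k = blk lo ++ blk (lo + 1) ++ ⋯ ++ blk (lo + k - 1)` with possibly empty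
blocks: membership, **a chain criterion** (`isChain_flatMapRange`: if every block is a chain for a
relation `R`, every nonempty block starts at its entry point, an empty block passes its entry
point on, and the last point of a nonempty block is related to the next entry point, then the whole
list is an `R`-chain, starts at the first entry point and its last point is related to the final
entry point), a no-duplicate criterion, and the two ways a pair of consecutive points sits in the
list (inside a block, or last point of a block followed by the next entry point). [folklore]
-/

namespace Summit.CriticalPhenomena.CardyFormulaZ2.Theorems.CardyQContinuation

namespace BlockList

variable {α : Type*}

/-- The concatenation of the blocks `blk lo, blk (lo + 1), …, blk (lo + k - 1)`. [folklore] -/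
def flatMapRange (blk : ℕ → List α) (lo k : ℕ) : List α := ((List.range' lo k).map blk).flatten

/-- No blocks: the empty list. [folklore] -/
@[simp] theorem flatMapRange_zero (blk : ℕ → List α) (lo : ℕ) : flatMapRange blk lo 0 = [] := rfl

/-- Peeling off the first block. [folklore] -/
theorem flatMapRange_succ (blk : ℕ → List α) (lo k : ℕ) :
    flatMapRange blk lo (k + 1) = blk lo ++ flatMapRange blk (lo + 1) k := by
  simp [flatMapRange, List.range'_succ]

/-- Peeling off the last block. [folklore] -/
theorem flatMapRange_succ' (blk : ℕ → List α) (lo k : ℕ) :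
    flatMapRange blk lo (k + 1) = flatMapRange blk lo k ++ blk (lo + k) := by
  induction k generalizing lo with
  | zero => simp [flatMapRange_succ]
  | succ k ih =>
    rw [flatMapRange_succ, ih, flatMapRange_succ, List.append_assoc,
      show lo + 1 + k = lo + (k + 1) by omega]

/-- Splitting after `k` blocks. [folklore] -/
theorem flatMapRange_add (blk : ℕ → List α) (lo k k' : ℕ) :
    flatMapRange blk lo (k + k') = flatMapRange blk lo k ++ flatMapRange blk (lo + k) k' := by
  induction k' with
  | zero => simp
  | succ k' ih => rw [← Nat.add_assoc, flatMapRange_succ', ih, flatMapRange_succ', List.append_assoc, Nat.add_assoc]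

/-- **Membership**: a point of the list lies in one of the blocks. [folklore] -/
theorem mem_flatMapRange_iff {blk : ℕ → List α} {lo k : ℕ} {x : α} :
    x ∈ flatMapRange blk lo k ↔ ∃ i, lo ≤ i ∧ i < lo + k ∧ x ∈ blk i := by
  simp only [flatMapRange, List.mem_flatten, List.mem_map, List.mem_range'_1]
  constructor
  · rintro ⟨l, ⟨i, ⟨hi1, hi2⟩, rfl⟩, hx⟩
    exact ⟨i, hi1, hi2, hx⟩
  · rintro ⟨i, hi1, hi2, hx⟩
    exact ⟨blk i, ⟨i, ⟨hi1, hi2⟩, rfl⟩, hx⟩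

/-- A block is an infix of the list. [folklore] -/
theorem infix_flatMapRange (blk : ℕ → List α) {lo k i : ℕ} (hi1 : lo ≤ i) (hi2 : i < lo + k) :
    blk i <:+: flatMapRange blk lo k := by
  obtain ⟨t, rfl⟩ : ∃ t, i = lo + t := ⟨i - lo, by omega⟩
  have hk : k = t + (k - t) := by omega
  rw [hk, flatMapRange_add]
  obtain ⟨k', hk'⟩ : ∃ k', k - t = k' + 1 := ⟨k - t - 1, by omega⟩
  rw [hk', flatMapRange_succ]
  exact List.infix_append' _ _ _

/-- The list is empty iff all its blocks are. [folklore] -/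
theorem flatMapRange_eq_nil_iff {blk : ℕ → List α} {lo k : ℕ} :
    flatMapRange blk lo k = [] ↔ ∀ i, lo ≤ i → i < lo + k → blk i = [] := by
  induction k generalizing lo with
  | zero => simp only [flatMapRange_zero, Nat.add_zero, true_iff]; intro i h1 h2; omega
  | succ k ih =>
    rw [flatMapRange_succ, List.append_eq_nil_iff, ih]
    constructor
    · rintro ⟨h1, h2⟩ i hi1 hi2
      rcases Nat.eq_or_lt_of_le hi1 with rfl | hlt
      · exact h1
      · exact h2 i hlt (by omega)
    · intro h
      exact ⟨h lo le_rfl (by omega), fun i hi1 hi2 ↦ h i (by omega) (by omega)⟩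

section Chain

variable {R : α → α → Prop} {blk : ℕ → List α} {entry : ℕ → α}
  (hE1 : ∀ i, blk i ≠ [] → (blk i).head? = some (entry i))
  (hE2 : ∀ i, blk i = [] → entry (i + 1) = entry i)
  (hE3 : ∀ i (h : blk i ≠ []), R ((blk i).getLast h) (entry (i + 1)))
  (hE4 : ∀ i, (blk i).IsChain R)
include hE2 in
/-- Across a stretch of empty blocks the entry point does not move. [folklore] -/
theorem entry_eq_of_forall_nil {lo k : ℕ} (h : ∀ i, lo ≤ i → i < lo + k → blk i = []) :
    entry (lo + k) = entry lo := by
  induction k with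
  | zero => rfl
  | succ k ih =>
    rw [← Nat.add_assoc, hE2 _ (h _ (by omega) (by omega)), ih fun i hi1 hi2 ↦ h i hi1 (by omega)]

include hE1 hE2 hE3 hE4 in
/-- **Chain criterion for lists of blocks.** If every block is an `R`-chain, a nonempty block
starts at its entry point, an empty block hands its entry point on to the next block, and the
last point of a nonempty block is `R`-related to the next entry point, then the concatenation of
the blocks `lo, …, lo + k - 1` is an `R`-chain, it starts at `entry lo`, and its last point is
`R`-related to `entry (lo + k)`. [folklore] -/
theorem isChain_flatMapRange (lo k : ℕ) :
    (flatMapRange blk lo k).IsChain R ∧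
      (flatMapRange blk lo k ≠ [] → (flatMapRange blk lo k).head? = some (entry lo)) ∧
      (∀ h : flatMapRange blk lo k ≠ [], R ((flatMapRange blk lo k).getLast h) (entry (lo + k))) := by
  induction k generalizing lo with
  | zero => simp
  | succ k ih =>
    obtain ⟨ihc, ihh, ihl⟩ := ih (lo + 1)
    have hlk : lo + 1 + k = lo + (k + 1) := by omega
    rw [hlk] at ihl
    by_cases hb : blk lo = []
    · have heq : flatMapRange blk lo (k + 1) = flatMapRange blk (lo + 1) k := by
        rw [flatMapRange_succ, hb, List.nil_append]
      rw [heq, hE2 _ hb] at *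
      exact ⟨ihc, ihh, ihl⟩
    · rw [flatMapRange_succ]
      refine ⟨?_, ?_, ?_⟩
      · rw [List.isChain_append]
        refine ⟨hE4 lo, ihc, fun x hx y hy ↦ ?_⟩
        rw [List.getLast?_eq_getLast_of_ne_nil hb, Option.mem_def, Option.some.injEq] at hx
        have hne : flatMapRange blk (lo + 1) k ≠ [] := by
          rintro h; rw [h] at hy; simp at hy
        rw [ihh hne, Option.mem_def, Option.some.injEq] at hy
        subst hx hy
        exact hE3 lo hb
      · intro _
        rw [List.head?_append, hE1 lo hb, Option.some_or]
      · intro h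
        by_cases hne : flatMapRange blk (lo + 1) k = []
        · have hlast : (blk lo ++ flatMapRange blk (lo + 1) k).getLast h = (blk lo).getLast hb := by
            simp [hne]
          rw [hlast]
          have hall := (flatMapRange_eq_nil_iff.1 hne)
          have := entry_eq_of_forall_nil hE2 (lo := lo + 1) (k := k) hall
          rw [hlk] at this
          rw [this]
          simpa using hE3 lo hb
        · rw [List.getLast_append_of_right_ne_nil _ _ hne]
          exact ihl hne

end Chain

/-- **No duplicates**: if the blocks have no duplicates and are pairwise disjoint, the list has no
duplicates. [folklore] -/
theorem nodup_flatMapRange {blk : ℕ → List α} {lo k : ℕ} (h1 : ∀ i, lo ≤ i → i < lo + k → (blk i).Nodup)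
    (h2 : ∀ i j, lo ≤ i → i < j → j < lo + k → List.Disjoint (blk i) (blk j)) :
    (flatMapRange blk lo k).Nodup := by
  induction k with
  | zero => simp
  | succ k ih =>
    rw [flatMapRange_succ', List.nodup_append]
    refine ⟨ih (fun i hi1 hi2 ↦ h1 i hi1 (by omega)) (fun i j hi hij hj ↦ h2 i j hi hij (by omega)),
      h1 _ (by omega) (by omega), ?_⟩
    intro x hx y hy
    obtain ⟨i, hi1, hi2, hxi⟩ := mem_flatMapRange_iff.1 hx
    rintro rfl
    exact h2 i (lo + k) hi1 hi2 (by omega) hxi hy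

/-- **Consecutive pairs, first kind**: two consecutive points of a block are consecutive in the
list (an infix of length two). [folklore] -/
theorem pair_infix_of_infix_blk (blk : ℕ → List α) {lo k i : ℕ} (hi1 : lo ≤ i) (hi2 : i < lo + k)
    {x y : α} (h : [x, y] <:+: blk i) : [x, y] <:+: flatMapRange blk lo k :=
  h.trans (infix_flatMapRange blk hi1 hi2)

/-- Splitting the list around the block `i`. [folklore] -/
theorem flatMapRange_decomp (blk : ℕ → List α) {lo k i : ℕ} (hi1 : lo ≤ i) (hi2 : i < lo + k) :
    flatMapRange blk lo k =
      flatMapRange blk lo (i - lo) ++ (blk i ++ flatMapRange blk (i + 1) (lo + k - (i + 1))) := by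
  have hk : k = (i - lo) + (1 + (lo + k - (i + 1))) := by omega
  conv_lhs => rw [hk]
  rw [flatMapRange_add, show lo + (i - lo) = i by omega, flatMapRange_add, flatMapRange_succ,
    flatMapRange_zero, List.append_nil]

/-- **Consecutive pairs, second kind**: the last point of a nonempty block followed by the first
point of the rest of the list. [folklore] -/
theorem pair_infix_of_getLast (blk : ℕ → List α) {lo k i : ℕ} (hi1 : lo ≤ i) (hi2 : i < lo + k)
    (hb : blk i ≠ []) {y : α} (hy : (flatMapRange blk (i + 1) (lo + k - (i + 1))).head? = some y) :
    [(blk i).getLast hb, y] <:+: flatMapRange blk lo k := by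
  rw [flatMapRange_decomp blk hi1 hi2]
  set rest := flatMapRange blk (i + 1) (lo + k - (i + 1)) with hrest
  obtain ⟨rest', hrest'⟩ : ∃ rest', rest = y :: rest' := by
    cases hr : rest with
    | nil => rw [hr] at hy; simp at hy
    | cons z zs =>
      rw [hr] at hy
      simp only [List.head?_cons, Option.some.injEq] at hy
      exact ⟨zs, by rw [hy]⟩
  rw [hrest']
  refine ⟨flatMapRange blk lo (i - lo) ++ (blk i).dropLast, rest', ?_⟩
  conv_rhs => rw [← List.dropLast_append_getLast hb]
  simp only [List.append_assoc, List.cons_append, List.nil_append]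

end BlockList

end Summit.CriticalPhenomena.CardyFormulaZ2.Theorems.CardyQContinuation
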